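import Summits.PneNP.PneNP.Theorems.CodingVolumeShiftsCodingVolumeLinearLevel

/-!
# Route CodingVolumeShifts — crux `CodingVolume` (stmt-PneNP-19454): the per-level inequality for
# linear one-shot codes

Part 4 of the `C = 4` rung for LINEAR one-shot codes (see `…LinearLabels`, `…LinearLevel`). With
`IS v` the span of the labels entering `v`, the POTENTIAL of the argument is
`Σ_{v middle} finrank (IS v) + Σ_i |In(sink i)| ≤ m`; it is filtered by the coordinate-killing maps
`f_R` (kill the coordinates of level `< R`). This file proves the PER-LEVEL INEQUALITY
(`codingVolume_linear_level`): for every level `r`,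

`Σ_{v middle} finrank (f_{r+1} (IS v)) + 4·|A_r| ≤ Σ_{v middle} finrank (f_r (IS v)) + Σ_{i ∈ A_r} |In(sink i)|`,

`A_r` the commodities of level `r`. Credits per middle vertex `v` (`codingVolume_linear_vertex`): the
subspace `Y v = Sσ v ⊔ SU v ⊔ SP v ≤ f_r (IS v)` is killed by `f_{r+1}`, where `Sσ v` is spanned by
the coordinates of the level-`r` commodities with an effective arc into `v`, `SU v` by the labels
(mod level `< r`) arriving from rank-`r` middle vertices, `SP v` by the coordinates of the level-`r`
commodities whose sink has a single in-arc, coming from `v`; its dimension is at least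
`|T v| + finrank (g (SU v)) + |P v|` (`g` = projection onto the commodities `A1` entering the middle
at a single vertex; disjoint supports by `Far 4`). Summing: effective arcs give `|A_r| + |A_r \ A1|`
(`codingVolume_linear_sum_T`), DEPARTURE gives `Σ_v finrank (g (SU v)) ≥ |A1|`
(`codingVolume_linear_sum_SU`), and the sinks give `Σ |In(sink i)| + Σ |P v| ≥ 2|A_r|`
(`codingVolume_linear_sinks`). No definitions.
-/

set_option linter.dupNamespace false -- `Summit.PneNP.PneNP.…`: summit = sub-problem name (D-0017)

namespace Summit.PneNP.PneNP.Theorems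

open Literature.InformationTheory.NetworkCoding Module Submodule Finset

section Count

variable {K : Type*} [Field K] {ι : Type} [Fintype ι] [DecidableEq ι] {N : KPairsNet ι}
  {φ : N.A → Module.Dual K (ι → K)}

/-- Killing the coordinates of level `< r` and then those of level `< r + 1` is killing those of
level `< r + 1`. [folklore] -/
theorem codingVolume_linear_comp_kill (hr : ι → ℕ) (r : ℕ)
    {f f' : Module.Dual K (ι → K) →ₗ[K] Module.Dual K (ι → K)}
    (hf : ∀ i, f (LinearMap.proj i) = if i ∈ {j | hr j < r} then 0 else LinearMap.proj i)
    (hf' : ∀ i, f' (LinearMap.proj i) = if i ∈ {j | hr j < r + 1} then 0 else LinearMap.proj i) :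
    f'.comp f = f' := by
  classical
  refine codingVolume_dual_hom_ext fun i => ?_
  rw [codingVolume_kill_comp hf' hf i, hf' i]
  by_cases h1 : hr i < r + 1
  · have hmem : i ∈ ({j | hr j < r + 1} ∪ {j | hr j < r} : Set ι) := Or.inl h1
    rw [if_pos hmem, if_pos (show i ∈ {j | hr j < r + 1} from h1)]
  · have hmem : i ∉ ({j | hr j < r + 1} ∪ {j | hr j < r} : Set ι) := by
      rintro (h | h)
      · exact h1 h
      · exact h1 (Nat.lt_succ_of_lt h)
    rw [if_neg hmem, if_neg (show i ∉ {j | hr j < r + 1} from h1)]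

/-- **Per-vertex credit.** For a middle vertex `v`, with `T` the level-`r` commodities having an
effective arc into `v`, `P` the level-`r` commodities whose sink has a single in-arc, with tail `v`,
and `SU` the span of the labels (mod level `< r`) on the arcs into `v` from rank-`r` middle vertices:
`finrank (f_{r+1} (IS v)) + |T| + finrank (g SU) + |P| ≤ finrank (f_r (IS v))`. [folklore] -/
theorem codingVolume_linear_vertex
    (hloc : ∀ b, φ b ∈ span K (φ '' ↑(N.inArcs (N.src b)) ∪
      (fun i => (LinearMap.proj i : Module.Dual K (ι → K))) '' {i | N.source i = N.src b}))
    (hdec : ∀ i, (LinearMap.proj i : Module.Dual K (ι → K)) ∈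
      span K (φ '' ↑(N.inArcs (N.sink i))))
    (hfar : N.Far 4) (hr : ι → ℕ)
    (hrA : ∀ i, ∃ a, N.src a = N.source i ∧ (∀ l, N.tgt a ≠ N.sink l) ∧ φ a ≠ 0 ∧
      N.rank (N.tgt a) = hr i)
    (hhr : ∀ i a, N.src a = N.source i → (∀ l, N.tgt a ≠ N.sink l) → φ a ≠ 0 →
      hr i ≤ N.rank (N.tgt a))
    (r : ℕ) {f f' g : Module.Dual K (ι → K) →ₗ[K] Module.Dual K (ι → K)}
    (hf : ∀ i, f (LinearMap.proj i) = if i ∈ {j | hr j < r} then 0 else LinearMap.proj i)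
    (hf' : ∀ i, f' (LinearMap.proj i) = if i ∈ {j | hr j < r + 1} then 0 else LinearMap.proj i)
    (A1 : Finset ι)
    (hA1 : ∀ j, j ∈ A1 ↔ hr j = r ∧ ∀ a a', N.src a = N.source j → N.src a' = N.source j →
      (∀ l, N.tgt a ≠ N.sink l) → (∀ l, N.tgt a' ≠ N.sink l) → φ a ≠ 0 → φ a' ≠ 0 →
      N.tgt a = N.tgt a')
    (hg : ∀ i, g (LinearMap.proj i) = if i ∈ {j | j ∉ A1} then 0 else LinearMap.proj i)
    (v : N.V) (hvt : ∀ j, v ≠ N.sink j)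
    (T : Finset ι) (hT : ∀ i, i ∈ T ↔ hr i = r ∧ ∃ a, N.src a = N.source i ∧ N.tgt a = v ∧ φ a ≠ 0)
    (P : Finset ι) (hP : ∀ i, i ∈ P ↔ hr i = r ∧ (N.inArcs (N.sink i)).card ≤ 1 ∧
      ∃ b ∈ N.inArcs (N.sink i), N.src b = v) :
    finrank K ((span K (φ '' ↑(N.inArcs v))).map f') + T.card +
      finrank K (((span K (φ '' {b | N.tgt b = v ∧ (∀ j, N.src b ≠ N.source j) ∧
        N.rank (N.src b) = r})).map f).map g) + P.card ≤
      finrank K ((span K (φ '' ↑(N.inArcs v))).map f) := by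
  classical
  -- notation
  set IS : Submodule K (Module.Dual K (ι → K)) := span K (φ '' ↑(N.inArcs v)) with hIS
  set SU : Submodule K (Module.Dual K (ι → K)) := (span K (φ '' {b | N.tgt b = v ∧
    (∀ j, N.src b ≠ N.source j) ∧ N.rank (N.src b) = r})).map f with hSU
  set Sσ : Submodule K (Module.Dual K (ι → K)) :=
    span K ((fun i => (LinearMap.proj i : Module.Dual K (ι → K))) '' ↑T) with hSσ
  set SP : Submodule K (Module.Dual K (ι → K)) :=
    span K ((fun i => (LinearMap.proj i : Module.Dual K (ι → K))) '' ↑P) with hSP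
  -- (0) basic facts about the generators
  -- an effective arc `a : source i → v` puts `proj i` in `IS`
  have hT_IS : ∀ i ∈ T, (LinearMap.proj i : Module.Dual K (ι → K)) ∈ IS := by
    intro i hi
    obtain ⟨-, a, ha, hav, hz⟩ := (hT i).mp hi
    have hφa := codingVolume_label_source hloc a ha
    rw [mem_span_singleton] at hφa
    obtain ⟨c0, hc0⟩ := hφa
    have hc : c0 ≠ 0 := by rintro rfl; exact hz (by rw [← hc0, zero_smul])
    have hmem : φ a ∈ IS := subset_span ⟨a, by simp [KPairsNet.inArcs, hav], rfl⟩
    have : (LinearMap.proj i : Module.Dual K (ι → K)) = c0⁻¹ • φ a := by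
      rw [← hc0, smul_smul, inv_mul_cancel₀ hc, one_smul]
    rw [this]
    exact smul_mem _ _ hmem
  -- pure sinks: `proj i ∈ IS` for `i ∈ P`
  have hP_IS : ∀ i ∈ P, (LinearMap.proj i : Module.Dual K (ι → K)) ∈ IS := by
    intro i hi
    obtain ⟨-, hcard, b, hb, hbv⟩ := (hP i).mp hi
    have hfar2 : (2 : ℕ∞) ≤ N.graph.edist (N.source i) (N.sink i) :=
      le_trans (by exact_mod_cast (by norm_num : (2 : ℕ) ≤ 4)) (hfar i)
    obtain ⟨b', hb', -, -, hknow⟩ := codingVolume_pure_sink hloc hdec i hfar2 hcard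
    have hbb : b = b' := by rw [hb'] at hb; exact Finset.mem_singleton.mp hb
    subst hbb
    rw [hbv] at hknow
    exact hknow
  -- `f` fixes `proj i` for `hr i = r`; `f'` kills it
  have hf_fix : ∀ i, hr i = r → f (LinearMap.proj i) = (LinearMap.proj i : Module.Dual K (ι → K)) :=
    fun i hi => by rw [hf i, if_neg (by simp [hi])]
  have hf'_kill : ∀ i, hr i = r → f' (LinearMap.proj i) = 0 :=
    fun i hi => by rw [hf' i, if_pos (by simp [hi])]
  -- labels from a rank-`r` middle tail into `v`: support and behaviour under `f`, `f'`
  have hU_supp : ∀ b, N.tgt b = v → (∀ j, N.src b ≠ N.source j) → N.rank (N.src b) = r →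
      f (φ b) ∈ span K ((fun i => (LinearMap.proj i : Module.Dual K (ι → K))) ''
        {j | ∃ a, N.src a = N.source j ∧ N.tgt a = N.src b ∧ φ a ≠ 0}) ∧ f' (φ b) = 0 := by
    intro b hbv hbM hbr
    have hsup := codingVolume_level_out_support hloc hr hhr r b hbM hbr
    constructor
    · refine span_mono (Set.image_mono ?_) (codingVolume_kill_map_span_le hf _ (mem_map_of_mem hsup))
      rintro j ⟨hj, hjr⟩
      rcases hj with hj | hj
      · exact hj
      · exact absurd hj hjr
    · refine codingVolume_kill_eq_zero_of_mem_span hf' ?_ hsup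
      rintro j (⟨a, ha, hat, hz⟩ | hj)
      · have hM : ∀ l, N.tgt a ≠ N.sink l := fun l hl => N.sink_out b l (hat.symm.trans hl)
        have := hhr j a ha hM hz
        rw [hat, hbr] at this
        show hr j < r + 1
        exact Nat.lt_succ_of_le this
      · show hr j < r + 1
        exact Nat.lt_succ_of_lt hj
  -- (Y1) `Y ≤ IS.map f`
  have hY1 : Sσ ⊔ SU ⊔ SP ≤ IS.map f := by
    refine sup_le (sup_le ?_ ?_) ?_
    · refine span_le.mpr ?_
      rintro ψ ⟨i, hi, rfl⟩
      have hir : hr i = r := ((hT i).mp hi).1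
      show (LinearMap.proj i : Module.Dual K (ι → K)) ∈ IS.map f
      rw [← hf_fix i hir]
      exact mem_map_of_mem (hT_IS i hi)
    · refine map_mono (span_mono ?_)
      rintro ψ ⟨b, ⟨hbv, -, -⟩, rfl⟩
      exact ⟨b, by simp [KPairsNet.inArcs, hbv], rfl⟩
    · refine span_le.mpr ?_
      rintro ψ ⟨i, hi, rfl⟩
      have hir : hr i = r := ((hP i).mp hi).1
      show (LinearMap.proj i : Module.Dual K (ι → K)) ∈ IS.map f
      rw [← hf_fix i hir]
      exact mem_map_of_mem (hP_IS i hi)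
  -- (Y2) `Y ≤ ker f'`
  have hY2 : Sσ ⊔ SU ⊔ SP ≤ LinearMap.ker f' := by
    refine sup_le (sup_le ?_ ?_) ?_
    · refine span_le.mpr ?_
      rintro ψ ⟨i, hi, rfl⟩
      exact (LinearMap.mem_ker).mpr (hf'_kill i ((hT i).mp hi).1)
    · rw [hSU, map_le_iff_le_comap]
      refine span_le.mpr ?_
      rintro ψ ⟨b, ⟨hbv, hbM, hbr⟩, rfl⟩
      rw [SetLike.mem_coe, mem_comap, LinearMap.mem_ker]
      have hcomp := codingVolume_linear_comp_kill (K := K) hr r hf hf'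
      rw [← LinearMap.comp_apply, hcomp]
      exact (hU_supp b hbv hbM hbr).2
    · refine span_le.mpr ?_
      rintro ψ ⟨i, hi, rfl⟩
      exact (LinearMap.mem_ker).mpr (hf'_kill i ((hP i).mp hi).1)
  -- hence `finrank (IS.map f') + finrank Y ≤ finrank (IS.map f)`
  have hmain := codingVolume_finrank_map_add_le f' hY1 hY2
  have hmapmap : (IS.map f).map f' = IS.map f' := by
    rw [← Submodule.map_comp, codingVolume_linear_comp_kill (K := K) hr r hf hf']
  rw [hmapmap] at hmain
  -- (Y3) `finrank Y = finrank (Sσ ⊔ SU) + |P|` (disjoint supports)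
  have hY3 : finrank K (Sσ ⊔ SU ⊔ SP : Submodule K (Module.Dual K (ι → K))) = finrank K (Sσ ⊔ SU : Submodule K (Module.Dual K (ι → K))) + P.card := by
    have hsupp : Sσ ⊔ SU ≤ span K ((fun i => (LinearMap.proj i : Module.Dual K (ι → K))) ''
        {j | j ∉ P}) := by
      refine sup_le ?_ ?_
      · refine span_mono (Set.image_mono ?_)
        intro i hi hiP
        -- effective arc `source i → v` and the single in-arc of `sink i` from `v`: distance 2
        obtain ⟨-, a, ha, hav, -⟩ := (hT i).mp hi
        obtain ⟨-, -, b, hb, hbv⟩ := (hP i).mp hiP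
        have hbt : N.tgt b = N.sink i := by simpa [KPairsNet.inArcs] using hb
        have h1 : N.graph.Adj (N.source i) v := by rw [← ha, ← hav]; exact codingVolume_adj_arc a
        have h2 : N.graph.Adj v (N.sink i) := by rw [← hbv, ← hbt]; exact codingVolume_adj_arc b
        have hw := codingVolume_le_length_of_far (hfar i)
          (SimpleGraph.Walk.cons h1 (SimpleGraph.Walk.cons h2 SimpleGraph.Walk.nil))
        simp at hw
      · rw [hSU, map_le_iff_le_comap]
        refine span_le.mpr ?_
        rintro ψ ⟨b, ⟨hbv, hbM, hbr⟩, rfl⟩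
        rw [SetLike.mem_coe, mem_comap]
        refine span_mono (Set.image_mono ?_) (hU_supp b hbv hbM hbr).1
        rintro j ⟨a, ha, hat, -⟩ hjP
        -- `source j → src b → v → sink j`: distance 3
        obtain ⟨-, -, b', hb', hb'v⟩ := (hP j).mp hjP
        have hbt : N.tgt b' = N.sink j := by simpa [KPairsNet.inArcs] using hb'
        have h1 : N.graph.Adj (N.source j) (N.src b) := by
          rw [← ha, ← hat]; exact codingVolume_adj_arc a
        have h2 : N.graph.Adj (N.src b) v := by rw [← hbv]; exact codingVolume_adj_arc b
        have h3 : N.graph.Adj v (N.sink j) := by rw [← hb'v, ← hbt]; exact codingVolume_adj_arc b'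
        have hw := codingVolume_le_length_of_far (hfar j)
          (SimpleGraph.Walk.cons h1 (SimpleGraph.Walk.cons h2
            (SimpleGraph.Walk.cons h3 SimpleGraph.Walk.nil)))
        simp at hw
    have hdisj : Disjoint ({j | j ∉ P} : Set ι) (↑P : Set ι) :=
      Set.disjoint_left.mpr fun j hj hjP => hj hjP
    rw [codingVolume_finrank_sup_of_disjoint_support hdisj hsupp le_rfl,
      codingVolume_finrank_span_proj]
  -- (Y4) `finrank (Sσ ⊔ SU) ≥ |T| + finrank (g SU)`
  have hSσ_card : finrank K Sσ = T.card := codingVolume_finrank_span_proj T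
  have hY4 : T.card + finrank K (SU.map g) ≤ finrank K (Sσ ⊔ SU : Submodule K (Module.Dual K (ι → K))) := by
    by_cases hcase : ∃ i ∈ T, i ∈ A1
    · -- `v` is the entry vertex of an `A1`-commodity, so it has rank `r` and `SU = ⊥`
      obtain ⟨i, hiT, hiA⟩ := hcase
      obtain ⟨hir, a, ha, hav, hz⟩ := (hT i).mp hiT
      have hrank : N.rank v = r := by
        obtain ⟨a₀, ha₀, hM₀, hz₀, hrk₀⟩ := hrA i
        have huniq := ((hA1 i).mp hiA).2 a a₀ ha ha₀ (fun l hl => hvt l (by rw [← hl, hav])) hM₀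
          hz hz₀
        rw [← hav, huniq, hrk₀, hir]
      have hSU_bot : SU = ⊥ := by
        rw [hSU, eq_bot_iff, map_le_iff_le_comap]
        refine span_le.mpr ?_
        rintro ψ ⟨b, ⟨hbv, -, hbr⟩, rfl⟩
        exfalso
        have := N.rank_lt b
        rw [hbr, hbv, hrank] at this
        exact lt_irrefl _ this
      rw [hSU_bot, Submodule.map_bot, finrank_bot, add_zero, sup_bot_eq, hSσ_card]
    · -- no `A1`-commodity enters at `v`: `g` kills `Sσ`
      push Not at hcase
      have hgSσ : Sσ.map g = ⊥ := by
        rw [eq_bot_iff, map_le_iff_le_comap]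
        refine span_le.mpr ?_
        rintro ψ ⟨i, hi, rfl⟩
        rw [SetLike.mem_coe, mem_comap, hg i, if_pos (show i ∈ {j | j ∉ A1} from hcase i hi)]
        exact zero_mem _
      have hq := codingVolume_finrank_map_quotient_le g (le_sup_left : Sσ ≤ Sσ ⊔ SU)
      rw [hgSσ, finrank_bot, add_zero, hSσ_card] at hq
      have hmono : finrank K (SU.map g) ≤ finrank K ((Sσ ⊔ SU).map g) :=
        Submodule.finrank_mono (map_mono le_sup_right)
      omega
  -- assemble
  have hmain' : finrank K (IS.map f') + finrank K (Sσ ⊔ SU ⊔ SP : Submodule K (Module.Dual K (ι → K))) ≤ finrank K (IS.map f) :=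
    hmain
  omega

end Count

end Summit.PneNP.PneNP.Theorems
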